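import Literature.Analysis.FluidPDE.TimePeriodicNSLatticeLinearForced
import HarnessLib

/-!
# The Leibniz rule of the time-periodic Navier–Stokes lattice and the phase vector in the kernel (Iooss 1972 §3; Henry 1981 §8.2)

Analysis/FluidPDE proof file (theorems only; no definitions, no named facts), a supplement to
`PeriodicNSOrbitPersistsProofs` (§E, the linearisation at the orbit) and
`TimePeriodicNSLatticeLinearForced`.  Two identities of the space–time Fourier lattice
`ℤ × ℤ³` of a `τ`-periodic orbit `u` of the forced Navier–Stokes system on `T³`:

* `nl_leibniz`: the **Leibniz rule** of the convective symbol in the time frequency,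
  `(2πi n) N(a,b)(n,k) = N((2πi n') a, b)(n,k) + N(a, (2πi n') b)(n,k)` for lattice families
  `a`, `b` with rapidly decaying extension to `ℤ⁴` — the Fourier form of
  `∂ₜ((v·∇)w) = ((∂ₜv)·∇)w + (v·∇)(∂ₜw)`: inside the convolution `n = n' + (n − n')`, and the
  two resulting series converge absolutely;
* `phase_mem_ker`: the **phase vector is in the kernel of the lattice linearisation**: for the
  orbit `x₀ = Λû ∈ W` and its time-derivative direction `g = (2πi n) x₀`,
  `τ⁻¹ Dₛg + L₀g + B(x₀,g) + B(g,x₀) = 0` — the Fourier form of "`∂ₜu` solves the linearised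
  equation around `u`", i.e. `∂ₜu` is a Floquet vector for the multiplier `1` (Iooss 1972, §3;
  Henry 1981, §8.2): multiply the orbit's projected lattice equation
  `σ(n,k) û + Π_k N(û,û) = [n = 0] f̂(k)` by `2πi n` (the right-hand side is time independent,
  so it drops out) and split `(2πi n) N(û,û)` with the Leibniz rule.

These are the two ingredients that make the transversality condition of the fold of cycles
independent of the chosen kernel representative.

## References

* G. Iooss, *Bifurcation des solutions périodiques de certains problèmes d'évolution*, /
  Arch. Rational Mech. Anal. 47 (1972) 301–329, §2–3. [Iooss1972]
* D. Henry, *Geometric Theory of Semilinear Parabolic Equations*, LNM 840 (1981), §8.2, Lemma 8.3.1. [Henry1981]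
* H. Kielhöfer, *Bifurcation Theory*, 2nd ed. (2012), §I.8 (PDF pp. 59–60), §I.12 (pp. 104–105). [Kielhofer2012]
-/

noncomputable section

open scoped BigOperators Topology ENNReal NNReal ComplexConjugate
open Filter Set Function MeasureTheory UnitAddTorus

namespace Literature.Analysis.FluidPDE

namespace TimePeriodicLattice

open Literature.Analysis.FunctionSpaces Literature.Analysis.FunctionSpaces.Torus
open Literature.Analysis.FunctionSpaces.EuclideanSpace
open Literature.Analysis.FluidPDE.ScalarFourier

-- BODY START
-- NOTATION START
/-- Local notation: the parabolic weight `Λ(n, k) = |n| + |k|²`. -/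
local notation:max "Λ" m:max => (|((Prod.fst m : ℤ) : ℝ)| + freqNormSq (Prod.snd m))

/-- Local notation: the convective symbol on `ℤ × ℤ³` (as in `TimePeriodicNSLattice`). -/
local notation:max "𝐍[" a ", " b "]" m:max =>
  (WithLp.toLp 2 (fun p : Fin 3 => ∑ j : Fin 3, ∑' m' : ℤ × (Fin 3 → ℤ),
    a m' j * (dsym j (Prod.snd m - Prod.snd m') * b (m - m') p)) : EuclideanSpace ℂ (Fin 3))

/-- Local notation: the lattice family `(n, k) ↦ C (Fin.cons n k)` of a family `C` on `ℤ⁴`. -/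
local notation:max "𝐋" C:max => (fun mm : ℤ × (Fin 3 → ℤ) => C (Fin.cons (Prod.fst mm) (Prod.snd mm) : Fin 4 → ℤ))

/-- Local notation: division by the weight. -/
local notation:max "𝐜" x:max => (fun mm : ℤ × (Fin 3 → ℤ) =>
  ((((|((Prod.fst mm : ℤ) : ℝ)| + freqNormSq (Prod.snd mm))⁻¹ : ℝ) : ℂ) • x mm))

/-- Local notation: multiplication by the weight. -/
local notation:max "𝐬" x:max => (fun mm : ℤ × (Fin 3 → ℤ) =>
  ((((|((Prod.fst mm : ℤ) : ℝ)| + freqNormSq (Prod.snd mm)) : ℝ) : ℂ) • x mm))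

/-- Local notation: the family of coefficients of `x ∈ W ⊂ ℓ²`. -/
local notation:max "𝐰" x:max =>
  (((x : lp (fun _ : ℤ × (Fin 3 → ℤ) => EuclideanSpace ℂ (Fin 3)) 2)) : ℤ × (Fin 3 → ℤ) → EuclideanSpace ℂ (Fin 3))

/-- Local notation: the extension `K ↦ c (K₀, tail K)` of a lattice family to `ℤ⁴`. -/
local notation:max "𝐄" c:max => (fun K : Fin 4 → ℤ => c ((K 0, Fin.tail K) : ℤ × (Fin 3 → ℤ)))

/-- Local notation: the lattice family `û(n,k) = 𝓕(complexify ∘ (U − m₀))(n,k)`. -/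
local notation:max "𝐮[" U ", " m₀ "]" => (fun mm : ℤ × (Fin 3 → ℤ) =>
  mFourierCoeff (EuclideanSpace.complexify ∘ fun y : UnitAddTorus (Fin 4) => U y - m₀)
    (Fin.cons (Prod.fst mm) (Prod.snd mm) : Fin 4 → ℤ))

/-- Local notation: the time multiplier `dₛ(n,k) = 2πi n / Λ(n,k)`. -/
local notation "dS" => (fun mm : ℤ × (Fin 3 → ℤ) =>
  (2 * Real.pi * Complex.I * ((Prod.fst mm : ℤ) : ℂ)) * ((((|((Prod.fst mm : ℤ) : ℝ)| + freqNormSq (Prod.snd mm)) : ℝ) : ℂ))⁻¹)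

/-- Local notation: the Stokes–drift multiplier `(4π²ν|k|² + 2πi m₀·k) / Λ(n,k)`. -/
local notation "dL[" ν ", " m₀ "]" => (fun mm : ℤ × (Fin 3 → ℤ) =>
  (((4 * Real.pi ^ 2 * ν * freqNormSq (Prod.snd mm) : ℝ) : ℂ) +
      2 * Real.pi * Complex.I * (∑ jj : Fin 3, ((m₀ jj : ℝ) : ℂ) * (((Prod.snd mm) jj : ℤ) : ℂ))) *
    ((((|((Prod.fst mm : ℤ) : ℝ)| + freqNormSq (Prod.snd mm)) : ℝ) : ℂ))⁻¹)

/-- Local notation: the symbol `σ_om(n,k) = 2πiomn + 4π²ν|k|² + 2πi m₀·k`. -/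
local notation "σ[" om ", " ν ", " m₀ "]" => (fun mm : ℤ × (Fin 3 → ℤ) =>
  2 * Real.pi * Complex.I * ((om : ℝ) : ℂ) * ((Prod.fst mm : ℤ) : ℂ) +
    (((4 * Real.pi ^ 2 * ν * freqNormSq (Prod.snd mm) : ℝ)) : ℂ) +
    2 * Real.pi * Complex.I * (∑ jj : Fin 3, ((m₀ jj : ℝ) : ℂ) * (((Prod.snd mm) jj : ℤ) : ℂ)))

/-- Local notation: the lattice family of the orbit `u` with period `τ`. -/
local notation:max "𝐨[" τ ", " u "]" => (fun mm : ℤ × (Fin 3 → ℤ) =>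
  mFourierCoeff (EuclideanSpace.complexify ∘ fun y : UnitAddTorus (Fin 4) => Torus.timeRoll τ u y - ∫ x, u 0 x)
    (Fin.cons (Prod.fst mm) (Prod.snd mm) : Fin 4 → ℤ))
-- NOTATION END

/-! ## §A⁹ The Leibniz rule of the convective symbol in the time frequency -/

section Leibniz

/-- The extension to `ℤ⁴` of the time-differentiated family `(2πi n) a` decays rapidly when
that of `a` does (the symbol `2πi K₀` of `∂₀` has linear growth; bookkeeping). [folklore] -/
theorem rapidDecay_ext_nsmul {a : ℤ × (Fin 3 → ℤ) → EuclideanSpace ℂ (Fin 3)} (har : RapidDecay (𝐄 a)) :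
    RapidDecay (𝐄 (fun mm : ℤ × (Fin 3 → ℤ) => (2 * Real.pi * Complex.I * (mm.1 : ℂ)) • a mm)) :=
  har.deriv 0

/-- **The Leibniz rule of the convective symbol in the time frequency** (the Fourier form of
`∂ₜ((v·∇)w) = ((∂ₜv)·∇)w + (v·∇)(∂ₜw)` on `T⁴`; Iooss 1972, §3, Henry 1981, §8.2, where the
linearised equation is differentiated along the orbit): for lattice families `a`, `b` with
rapidly decaying extension to `ℤ⁴` and every `m = (n, k)`,
`(2πi n) N(a,b)(m) = N((2πi n') a, b)(m) + N(a, (2πi n') b)(m)`.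
Inside the convolution `n = n' + (n − n')`; both resulting series converge absolutely. [folklore] -/
theorem nl_leibniz (a b : ℤ × (Fin 3 → ℤ) → EuclideanSpace ℂ (Fin 3)) (har : RapidDecay (𝐄 a)) (hbr : RapidDecay (𝐄 b))
    (m : ℤ × (Fin 3 → ℤ)) :
    (2 * Real.pi * Complex.I * (m.1 : ℂ)) • 𝐍[a, b] m =
      𝐍[(fun mm : ℤ × (Fin 3 → ℤ) => (2 * Real.pi * Complex.I * (mm.1 : ℂ)) • a mm), b] m +
        𝐍[a, (fun mm : ℤ × (Fin 3 → ℤ) => (2 * Real.pi * Complex.I * (mm.1 : ℂ)) • b mm)] m := by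
  ext p
  rw [PiLp.smul_apply, PiLp.add_apply, nl_apply, nl_apply,
    nl_apply a (fun mm : ℤ × (Fin 3 → ℤ) => (2 * Real.pi * Complex.I * (mm.1 : ℂ)) • b mm) m p, smul_eq_mul,
    Finset.mul_sum, ← Finset.sum_add_distrib]
  refine Finset.sum_congr rfl fun j _ => ?_
  -- both pieces are absolutely summable (the families are passed explicitly: no higher-order unification)
  have h₁ := summable_nl_term_of_rapidDecayE
    (a := fun mm : ℤ × (Fin 3 → ℤ) => (2 * Real.pi * Complex.I * (mm.1 : ℂ)) • a mm) (b := b)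
    (rapidDecay_ext_nsmul har) hbr m j p
  have h₂ := summable_nl_term_of_rapidDecayE (a := a)
    (b := fun mm : ℤ × (Fin 3 → ℤ) => (2 * Real.pi * Complex.I * (mm.1 : ℂ)) • b mm) har (rapidDecay_ext_nsmul hbr) m j p
  rw [← tsum_mul_left, ← h₁.tsum_add h₂]
  refine tsum_congr fun m' => ?_
  simp only [PiLp.smul_apply, smul_eq_mul, Prod.fst_sub, Int.cast_sub]
  ring

end Leibniz

/-! ## §B⁹ The phase vector is in the kernel of the lattice linearisation -/

section Linearisation

variable {W : Submodule ℝ (lp (fun _ : ℤ × (Fin 3 → ℤ) => EuclideanSpace ℂ (Fin 3)) 2)}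

variable {ν τ : ℝ} {f : UnitAddTorus (Fin 3) → EuclideanSpace ℝ (Fin 3)}
  {u : ℝ → UnitAddTorus (Fin 3) → EuclideanSpace ℝ (Fin 3)} {p : ℝ → UnitAddTorus (Fin 3) → ℝ}

variable (hW : ∀ x : lp (fun _ : ℤ × (Fin 3 → ℤ) => EuclideanSpace ℂ (Fin 3)) 2, x ∈ W ↔
      (∀ n : ℤ, (x : ℤ × (Fin 3 → ℤ) → EuclideanSpace ℂ (Fin 3)) (n, 0) = 0) ∧
      (∀ mm : ℤ × (Fin 3 → ℤ), (∑ jj : Fin 3, ((mm.2 jj : ℤ) : ℂ) *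
        ((x : ℤ × (Fin 3 → ℤ) → EuclideanSpace ℂ (Fin 3)) mm) jj) = 0) ∧
      (∀ mm : ℤ × (Fin 3 → ℤ), (x : ℤ × (Fin 3 → ℤ) → EuclideanSpace ℂ (Fin 3)) (-mm) =
        conjVec ((x : ℤ × (Fin 3 → ℤ) → EuclideanSpace ℂ (Fin 3)) mm)))
variable {Ds L₀ : W →L[ℝ] W} (hDs : ∀ (x : W) (m : ℤ × (Fin 3 → ℤ)), (𝐰 (Ds x)) m = dS m • (𝐰 x) m)
  (hL₀ : ∀ (x : W) (m : ℤ × (Fin 3 → ℤ)), (𝐰 (L₀ x)) m = dL[ν, ∫ x, u 0 x] m • (𝐰 x) m)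
variable {B : W → W → W} (hBf : ∀ (x y : W) (m : ℤ × (Fin 3 → ℤ)), (𝐰 (B x y)) m = Torus.lerayCoeff m.2 (𝐍[𝐜 (𝐰 x), 𝐜 (𝐰 y)] m))

include hW hDs hL₀ hBf in
/-- **The phase vector is in the kernel of the linearisation at the orbit** (Iooss 1972, §3;
Henry 1981, §8.2: `∂ₜu` solves the linearised equation around the `τ`-periodic orbit `u`,
i.e. `1` is a Floquet multiplier with Floquet vector `∂ₜu`; here on the Fourier side): for the
orbit `x₀ = Λû ∈ W` and `g ∈ W` with coefficients `(2πi n) Λ û` (the time-derivative direction,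
`g = (2πi n) x₀`), `τ⁻¹ Dₛg + L₀g + B(x₀,g) + B(g,x₀) = 0`.  Proof: off the zero spatial modes
the `m`-th coefficient of the left-hand side is `σ(m) (2πi n) û(m) + Π_k (N(û,(2πi n')û)(m) +
N((2πi n')û,û)(m)) = (2πi n) (σ(m) û(m) + Π_k N(û,û)(m))` by the Leibniz rule `nl_leibniz`, and
the orbit's lattice equation `orbit_equation` makes the bracket `[n = 0] f̂(k)`, which `2πi n`
kills (no sign condition on `ν` is needed: the identity is algebraic in the orbit's lattice
equation). [folklore] -/
theorem phase_mem_ker (hτ : 0 < τ) (hsol : Torus.IsClassicalNSSolutionOn univ ν (fun _ => f) u p)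
    (hper : Function.Periodic u τ) (hf0 : HasZeroMean f) (hfd : IsDivFree f)
    (x₀ : W) (hx₀ : 𝐰 x₀ = 𝐬 (𝐨[τ, u])) (g : W)
    (hg : 𝐰 g = fun mm : ℤ × (Fin 3 → ℤ) => (2 * Real.pi * Complex.I * (mm.1 : ℂ)) • (𝐬 (𝐨[τ, u])) mm) :
    τ⁻¹ • Ds g + L₀ g + (B x₀ g + B g x₀) = 0 := by
  have hu0 : ∀ n : ℤ, 𝐨[τ, u] ((n, 0) : ℤ × (Fin 3 → ℤ)) = 0 := orbit_zero_modes hsol hper hf0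
  have hur : RapidDecay (𝐄 (𝐨[τ, u])) := rapidDecay_ext_lattice (orbit_rapidDecay hsol hper)
  have hcx₀ : 𝐜 (𝐰 x₀) = 𝐨[τ, u] := by rw [hx₀]; exact cw_sw (x := 𝐨[τ, u]) hu0
  -- `g / Λ = (2πi n) û`
  have hg' : 𝐰 g = 𝐬 (fun mm : ℤ × (Fin 3 → ℤ) => (2 * Real.pi * Complex.I * (mm.1 : ℂ)) • 𝐨[τ, u] mm) := by
    rw [hg]; funext mm; exact smul_comm _ _ _
  have hcg : 𝐜 (𝐰 g) = fun mm : ℤ × (Fin 3 → ℤ) => (2 * Real.pi * Complex.I * (mm.1 : ℂ)) • 𝐨[τ, u] mm := by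
    rw [hg']
    exact cw_sw (x := fun mm : ℤ × (Fin 3 → ℤ) => (2 * Real.pi * Complex.I * (mm.1 : ℂ)) • 𝐨[τ, u] mm)
      (nsmul_zero_mode (x := 𝐨[τ, u]) hu0)
  refine W_ext fun m => ?_
  rw [coeW_zero, Pi.zero_apply]
  by_cases hm : m.2 = 0
  · exact W_zero' hW _ hm
  -- the Leibniz rule for `N(û, û)`
  have hsym : 𝐍[𝐨[τ, u], (fun mm : ℤ × (Fin 3 → ℤ) => (2 * Real.pi * Complex.I * (mm.1 : ℂ)) • 𝐨[τ, u] mm)] m +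
      𝐍[(fun mm : ℤ × (Fin 3 → ℤ) => (2 * Real.pi * Complex.I * (mm.1 : ℂ)) • 𝐨[τ, u] mm), 𝐨[τ, u]] m =
      (2 * Real.pi * Complex.I * (m.1 : ℂ)) • 𝐍[𝐨[τ, u], 𝐨[τ, u]] m := by
    rw [add_comm]; exact (nl_leibniz (𝐨[τ, u]) (𝐨[τ, u]) hur hur m).symm
  rw [coord_lin hDs hL₀ hBf g x₀ τ⁻¹ m, hcx₀, hcg, hsym, SteadyLattice.lerayCoeff_smul']
  -- the orbit equation multiplied by `2πi n` has vanishing right-hand side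
  have he2 : (2 * Real.pi * Complex.I * (m.1 : ℂ)) •
      (σ[τ⁻¹, ν, ∫ x, u 0 x] m • 𝐨[τ, u] m + Torus.lerayCoeff m.2 (𝐍[𝐨[τ, u], 𝐨[τ, u]] m)) = 0 := by
    rw [orbit_equation hsol hper hτ hfd m hm]
    split_ifs with h0
    · rw [h0, Int.cast_zero, mul_zero, zero_smul]
    · exact smul_zero _
  rwa [smul_add, smul_comm _ (σ[τ⁻¹, ν, ∫ x, u 0 x] m) (𝐨[τ, u] m)] at he2

end Linearisation

end TimePeriodicLattice

end Literature.Analysis.FluidPDE
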